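import Summits.CriticalPhenomena.CardyFormulaZ2.Theses.CardySelfDualSegment
import Literature.Probability.Percolation.CornerPercolation
import Literature.Probability.Percolation.LatticeSymmetry
import Literature.Barriers.CriticalPhenomena.EmbeddingModulusUniquenessProofs
import Literature.Probability.RandomPlanarGeometry.ConformalRectangleProofs
import Literature.Probability.RandomPlanarGeometry.CardyFunctionIncBeta
import Literature.Probability.RandomPlanarGeometry.ChordalCurveFamily
import Literature.Probability.RandomPlanarGeometry.ImageUnivalent
import Literature.Probability.LatticeModels.IsoradialGraphsProofs

/-!
# `SegmentOpen` (stmt-CriticalPhenomena-5471): the modulus of a good point lies on the unit circle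

Negative-side support for the crux `CardySelfDualSegment.SegmentOpen` (cdisprove unit; work file
`Cruxes/SegmentOpen/Disproof.lean`).  The crux's good set is `G = {t | ∃ α, 0 < im α ∧ CardyMod t α}`.
Here: for EVERY `t` and every `α` with `0 < im α` and `CardyMod t α`, `‖α‖ = 1` (`norm_eq_one_of_cardyMod`).
So the existential `∃ α` of the crux ranges effectively over the ARC `α = e^{iθ}`, `θ ∈ (0, π)`: the
modulus chart of line `Sketch` (`stub_accumulationInterior`) is ONE-dimensional (one test quad suffices),
and a refutation of the Target at some `t` needs only exclude the unit-circle moduli.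

Ingredients (all for an ABSTRACT family `P : ConformalRectangle → ℝ → ℝ`):
* `cardyModOf_conj` — `CardyMod α → CardyMod ᾱ` for any `P` (`φ_ᾱ R' = conj (φ_α R')` pointwise and
  conjugate rectangles have the same modulus; Beffara 2008, Prop. 4, conjugate half);
* `cardyModOf_inv_of_transpose` — if `P` is invariant under the diagonal reflection
  `τ w = i w̄` of the plane (`P (R'.map τ) = P R'`), then `CardyMod α → CardyMod α⁻¹`
  (`α · φ_{α⁻¹} = φ_α ∘ τ`, similarities preserve the modulus);
* `cornerCrossingProb_map_transpose` — the corner model's crude crossing probabilities ARE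
  `τ`-invariant at every mesh (`cornerPercolation_map_relabel_transpose` of the tree: the law of
  `M_t` is invariant under `(x₀,x₁) ↦ (x₁,x₀)`, which `squareLatticeEmbedding` intertwines with `τ`);
* modulus uniqueness (`BeffaraShearDistortsModulus_holds` + injectivity of `F`): `ᾱ⁻¹ = α/‖α‖²`
  and `α` are both good moduli in the upper half-plane, hence equal.
Refs: V. Beffara, Progr. Probab. 60 (2008), Prop. 4 and §2.2; Langlands–Pouliot–Saint-Aubin (1994).
-/

noncomputable section

namespace Summit.CriticalPhenomena.CardyFormulaZ2.Theorems.SegmentOpen.Negative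

open Set Filter Topology Complex
open scoped ComplexConjugate
open UpperHalfPlane (upperHalfPlaneSet)
open Literature.Probability.RandomPlanarGeometry
open Literature.Barriers.CriticalPhenomena
open Literature.Probability.Percolation (cornerCrossingProb cornerCrossingProb_eq cornerPercolation
  embDomainCrossing openCrossing transposeIso image_transposeIso preimage_relabel_openCrossing
  cornerPercolation_real_preimage_relabel_transpose)
open Literature.Probability.LatticeModels (Site squareLatticeEmbedding squareLatticeEmbedding_z)

/-! ## §0 The crux's Cardy-after-shear template (verbatim shape of the route's `CardyMod`) -/

/-- `CardyMod'` for an abstract family `P` of crossing functions and a modulus `α` (any `α : ℂ`):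
the crude crossing values `P R'` tend to Cardy's value of every presentation `R` of `φ_α R'`.
(Same body as the route's `let CardyMod`; primed name to keep this file independent.) [folklore] -/
def CardyMod' (P : ConformalRectangle → ℝ → ℝ) (α : ℂ) : Prop :=
  ∀ (R R' : ConformalRectangle) (φ : ConformalEquiv upperHalfPlaneSet R.carrier) (x : Fin 4 → ℝ),
    R.carrier = moduliShear α '' R'.carrier → (∀ i, R.pt i = moduliShear α (R'.pt i)) →
    R.IsUniformizing φ x → Tendsto (P R') (𝓝[>] 0) (𝓝 (cardyFunction (crossRatio x)))

/-! ## §1 Conjugate moduli (any family) -/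

/-- `φ_ᾱ = conj ∘ φ_α` pointwise. [cite: Beffara2008Universal, Proposition 4 (proof)] -/
theorem moduliShear_conj (α z : ℂ) : moduliShear (conj α) z = conj (moduliShear α z) := by
  apply Complex.ext <;> simp [moduliShear]

/-- `conj '' (φ_ᾱ '' S) = φ_α '' S`. [folklore] -/
theorem image_conj_image_moduliShear_conj (α : ℂ) (S : Set ℂ) :
    moduliShear (-I) '' (moduliShear (conj α) '' S) = moduliShear α '' S := by
  rw [image_image]
  refine image_congr fun z _ => ?_
  rw [moduliShear_neg_I_apply, moduliShear_conj, Complex.conj_conj]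

/-- **Conjugate moduli.** For ANY family `P`: Cardy limits after `φ_α` give Cardy limits after
`φ_ᾱ` (the conjugate rectangle `R*` of a presentation `R` of `φ_ᾱ R'` presents `φ_α R'`, and its
datum `(φ*, -x)` has the same cross-ratio). [cite: Beffara2008Universal, Proposition 4 (proof)] -/
theorem cardyModOf_conj {P : ConformalRectangle → ℝ → ℝ} {α : ℂ} (h : CardyMod' P α) :
    CardyMod' P (conj α) := by
  intro R R' φ x hc hp hu
  obtain ⟨ψ, -, hψ⟩ := hu.exists_conjugate
  have hc' : R.conjugate.carrier = moduliShear α '' R'.carrier := by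
    rw [conjugate_carrier_eq_image_moduliShear, hc, image_conj_image_moduliShear_conj]
  have hp' : ∀ i, R.conjugate.pt i = moduliShear α (R'.pt i) := fun i => by
    rw [conjugate_pt_eq_moduliShear, hp i, moduliShear_neg_I_apply, moduliShear_conj,
      Complex.conj_conj]
  have := h R.conjugate R' ψ (-x) hc' hp' hψ
  rwa [crossRatio_neg] at this

/-! ## §2 The diagonal reflection `τ w = i w̄` and inverse moduli -/

/-- The diagonal reflection of the plane, `τ w = i · w̄` (`x + iy ↦ y + ix`), an involutive isometry;
`squareLatticeEmbedding` intertwines the transposition of `ℤ²` with it. [folklore] -/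
def transposeHomeomorph : ℂ ≃ₜ ℂ where
  toFun w := I * conj w
  invFun w := I * conj w
  left_inv w := by simp [← mul_assoc]
  right_inv w := by simp [← mul_assoc]
  continuous_toFun := by fun_prop
  continuous_invFun := by fun_prop

/-- `τ w = i w̄`. [folklore] -/
@[simp] theorem transposeHomeomorph_apply (w : ℂ) : transposeHomeomorph w = I * conj w := rfl

/-- `τ` is an involution. [folklore] -/
theorem transposeHomeomorph_involutive (w : ℂ) : transposeHomeomorph (transposeHomeomorph w) = w :=
  transposeHomeomorph.left_inv w

/-- `τ` is an isometry. [folklore] -/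
theorem isometry_transposeHomeomorph : Isometry transposeHomeomorph :=
  Isometry.of_dist_eq fun x y => by
    simp only [transposeHomeomorph_apply, Complex.dist_eq]
    rw [← mul_sub, norm_mul, Complex.norm_I, one_mul, ← map_sub, Complex.norm_conj]

/-- `α · φ_{α⁻¹}(w) = φ_α (τ w)`: a shear by `α⁻¹` followed by the similarity `α·` is the shear by
`α` after the diagonal reflection. [folklore] -/
theorem mul_moduliShear_inv (α : ℂ) (hα : α ≠ 0) (w : ℂ) :
    α * moduliShear α⁻¹ w = moduliShear α (transposeHomeomorph w) := by
  simp only [moduliShear, transposeHomeomorph_apply, mul_re, I_re, conj_re, zero_mul, I_im, conj_im,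
    one_mul, zero_sub, neg_neg, mul_im, zero_add]
  field_simp
  ring

/-- **Inverse moduli under a diagonal symmetry.** If the family `P` is invariant under the
diagonal reflection of rectangles (`P (R'.map τ) = P R'` at every mesh), then Cardy limits after
`φ_α` give Cardy limits after `φ_{α⁻¹}`: a presentation `R` of `φ_{α⁻¹} R'` with datum `(φ, x)`
yields the presentation `α · R` of `φ_α (τ R')` with datum `(α · φ, x)`
(`IsUniformizing.image_data`). [folklore] -/
theorem cardyModOf_inv_of_transpose {P : ConformalRectangle → ℝ → ℝ}
    (hP : ∀ (R' : ConformalRectangle) (δ : ℝ), P (R'.map transposeHomeomorph) δ = P R' δ)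
    {α : ℂ} (hα : α ≠ 0) (h : CardyMod' P α) : CardyMod' P α⁻¹ := by
  intro R R' φ x hc hp hu
  -- the presentation `α · R` of `φ_α (τ R')`
  set R₂ := R.map (Homeomorph.mulLeft₀ α hα) with hR₂
  have hd : DifferentiableOn ℂ (fun z => α * z) R.carrier :=
    (differentiable_id.const_mul α).differentiableOn
  have hi : InjOn (fun z => α * z) R.carrier := (mul_right_injective₀ hα).injOn
  have hcl : ContinuousOn (fun z => α * z) (closure R.carrier) :=
    (continuous_const.mul continuous_id).continuousOn
  have hS : R₂.carrier = (fun z => α * z) '' R.carrier := rfl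
  have hpt : ∀ i, R₂.pt i = (fun z => α * z) (R.pt i) := fun _ => rfl
  have hu₂ := hu.image_data hd hi hcl hS hpt
  have hc₂ : R₂.carrier = moduliShear α '' (R'.map transposeHomeomorph).carrier := by
    rw [hS, hc, MarkedDomain.carrier_map, image_image, image_image]
    exact image_congr fun w _ => mul_moduliShear_inv α hα w
  have hp₂ : ∀ i, R₂.pt i = moduliShear α ((R'.map transposeHomeomorph).pt i) := fun i => by
    rw [hpt i, hp i, MarkedDomain.pt_map]
    exact mul_moduliShear_inv α hα (R'.pt i)
  have hlim := h R₂ (R'.map transposeHomeomorph) _ x hc₂ hp₂ hu₂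
  have hfun : P (R'.map transposeHomeomorph) = P R' := funext (hP R')
  rwa [hfun] at hlim

/-! ## §3 The corner model is invariant under the diagonal reflection -/

/-- `squareLatticeEmbedding` intertwines the transposition `(x₀, x₁) ↦ (x₁, x₀)` of `ℤ²` with `τ`.
[folklore] -/
theorem squareLatticeEmbedding_z_transpose (x : Site 2) :
    squareLatticeEmbedding.z (transposeIso x) = transposeHomeomorph (squareLatticeEmbedding.z x) := by
  rw [squareLatticeEmbedding_z, squareLatticeEmbedding_z, Literature.Probability.Percolation.transposeIso_apply,
    transposeHomeomorph_apply]
  apply Complex.ext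
  · simp [Literature.Probability.LatticeModels.Site.toComplex]
  · simp [Literature.Probability.LatticeModels.Site.toComplex]

/-- Rescaled version: `δ z (xᵀ) = τ (δ z x)` for real `δ`. [folklore] -/
theorem smul_z_transpose (δ : ℝ) (x : Site 2) :
    (δ : ℂ) * squareLatticeEmbedding.z (transposeIso x) =
      transposeHomeomorph ((δ : ℂ) * squareLatticeEmbedding.z x) := by
  rw [squareLatticeEmbedding_z_transpose, transposeHomeomorph_apply, transposeHomeomorph_apply,
    map_mul, Complex.conj_ofReal]
  ring

/-- The vertices whose rescaled position lies in `τ Ω` are the transposed vertices for `Ω`.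
[folklore] -/
theorem setOf_mem_transpose_image (Ω : Set ℂ) (δ : ℝ) :
    {y : Site 2 | (δ : ℂ) * squareLatticeEmbedding.z y ∈ transposeHomeomorph '' Ω} =
      (transposeIso : Site 2 → Site 2) '' {y : Site 2 | (δ : ℂ) * squareLatticeEmbedding.z y ∈ Ω} := by
  rw [image_transposeIso]
  ext y
  simp only [mem_setOf_eq, mem_preimage]
  constructor
  · rintro ⟨w, hw, hwy⟩
    have : transposeHomeomorph ((δ : ℂ) * squareLatticeEmbedding.z y) = w := by
      rw [← hwy]; exact transposeHomeomorph_involutive w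
    rw [smul_z_transpose, this]; exact hw
  · intro hy
    refine ⟨(δ : ℂ) * squareLatticeEmbedding.z (transposeIso y), hy, ?_⟩
    rw [smul_z_transpose]; exact transposeHomeomorph_involutive _

/-- The vertices within rescaled distance `2δ` of `τ A` are the transposed vertices for `A`.
[folklore] -/
theorem setOf_infDist_transpose_image (A : Set ℂ) (δ : ℝ) :
    {u : Site 2 | Metric.infDist ((δ : ℂ) * squareLatticeEmbedding.z u) (transposeHomeomorph '' A) ≤ 2 * δ} =
      (transposeIso : Site 2 → Site 2) ''
        {u : Site 2 | Metric.infDist ((δ : ℂ) * squareLatticeEmbedding.z u) A ≤ 2 * δ} := by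
  rw [image_transposeIso]
  ext u
  simp only [mem_setOf_eq, mem_preimage]
  have h : (δ : ℂ) * squareLatticeEmbedding.z u =
      transposeHomeomorph ((δ : ℂ) * squareLatticeEmbedding.z (transposeIso u)) := by
    rw [smul_z_transpose]; exact (transposeHomeomorph_involutive _).symm
  rw [h, Metric.infDist_image isometry_transposeHomeomorph]

/-- The crude crossing event of `(τ Ω; τ A, τ B)` has the same `M_t`-probability as that of
`(Ω; A, B)` (diagonal-reflection invariance of `M_t`, `cornerPercolation_real_preimage_relabel_transpose`).
[cite: BollobasRiordan2010, §2 Cor. 2.3] -/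
theorem corner_real_embDomainCrossing_transpose (t : unitInterval) (Ω A B : Set ℂ) (δ : ℝ) :
    (cornerPercolation t).real
        (embDomainCrossing squareLatticeEmbedding.z (transposeHomeomorph '' Ω) δ
          (transposeHomeomorph '' A) (transposeHomeomorph '' B)) =
      (cornerPercolation t).real (embDomainCrossing squareLatticeEmbedding.z Ω δ A B) := by
  unfold embDomainCrossing
  rw [setOf_mem_transpose_image, setOf_infDist_transpose_image, setOf_infDist_transpose_image]
  rw [← cornerPercolation_real_preimage_relabel_transpose t (openCrossing _ _ _)]
  congr 1
  exact preimage_relabel_openCrossing transposeIso.toEquiv _ _ _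

/-- **The corner model's crude crossing probabilities are `τ`-invariant** at every mesh.
[cite: BollobasRiordan2010, §2 Cor. 2.3] -/
theorem cornerCrossingProb_map_transpose (t : unitInterval) (R' : ConformalRectangle) (δ : ℝ) :
    cornerCrossingProb t (R'.map transposeHomeomorph) δ = cornerCrossingProb t R' δ := by
  rw [cornerCrossingProb_eq, cornerCrossingProb_eq, MarkedDomain.carrier_map, MarkedDomain.arc_map,
    MarkedDomain.arc_map]
  exact corner_real_embDomainCrossing_transpose t R'.carrier (R'.arc 0) (R'.arc 2) δ

/-! ## §4 Modulus uniqueness (Beffara) and `‖α‖ = 1` -/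

/-- Pull-back of a rectangle through `φ_α`: carrier. [folklore] -/
theorem carrier_eq_image_map_symm' (R : ConformalRectangle) {α : ℂ} (hα : α.im ≠ 0) :
    R.carrier = moduliShear α '' (R.map (shearHomeomorph α hα).symm).carrier := by
  rw [MarkedDomain.carrier_map, image_image]
  have : (fun z => moduliShear α ((shearHomeomorph α hα).symm z)) = id :=
    funext fun z => (shearHomeomorph α hα).apply_symm_apply z
  rw [this, image_id]

/-- Pull-back of a rectangle through `φ_α`: marked points. [folklore] -/
theorem pt_eq_moduliShear_map_symm' (R : ConformalRectangle) {α : ℂ} (hα : α.im ≠ 0) (i : Fin 4) :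
    R.pt i = moduliShear α ((R.map (shearHomeomorph α hα).symm).pt i) := by
  rw [MarkedDomain.pt_map]
  exact ((shearHomeomorph α hα).apply_symm_apply (R.pt i)).symm

/-- **Modulus uniqueness** for the template `CardyMod'` (any family): two moduli of the upper
half-plane with Cardy limits after their shears coincide. [cite: Beffara2008Universal, Proposition 4] -/
theorem modulus_unique' {P : ConformalRectangle → ℝ → ℝ} {α β : ℂ} (hα : 0 < α.im) (hβ : 0 < β.im)
    (hA : CardyMod' P α) (hB : CardyMod' P β) : α = β := by
  by_contra hne
  set γ : ℂ := (β - (α.re : ℂ)) / (α.im : ℂ) with hγ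
  have hγα : moduliShear γ α = β := moduliShear_connect hα.ne' β
  have hγim : 0 < γ.im := by rw [hγ, moduliShear_connect_im]; exact div_pos hβ hα
  have hγI : γ ≠ I := by
    intro h; apply hne; rw [← hγα, h, moduliShear_I_apply]
  obtain ⟨R₁, R₂, R₁', R₂', φ₁, x₁, φ₂, x₂, φ₁', x₁', φ₂', x₂', h₁, h₂, h₁', h₂', ⟨hc₁, hp₁⟩,
    ⟨hc₂, hp₂⟩, hcr, hcr'⟩ := BeffaraShearDistortsModulus_holds γ hγim hγI
  set Q₁ := R₁.map (shearHomeomorph α hα.ne').symm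
  set Q₂ := R₂.map (shearHomeomorph α hα.ne').symm
  have hcQ₁ := carrier_eq_image_map_symm' R₁ hα.ne'
  have hcQ₂ := carrier_eq_image_map_symm' R₂ hα.ne'
  have hpQ₁ := pt_eq_moduliShear_map_symm' R₁ hα.ne'
  have hpQ₂ := pt_eq_moduliShear_map_symm' R₂ hα.ne'
  have tA₁ := hA R₁ Q₁ φ₁ x₁ hcQ₁ hpQ₁ h₁
  have tA₂ := hA R₂ Q₂ φ₂ x₂ hcQ₂ hpQ₂ h₂
  have himg : ∀ S : Set ℂ, moduliShear γ '' (moduliShear α '' S) = moduliShear β '' S := fun S => by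
    rw [image_image]; exact image_congr fun z _ => by rw [moduliShear_moduliShear, hγα]
  have tB₁ := hB R₁' Q₁ φ₁' x₁' (by rw [hc₁, hcQ₁, himg])
    (fun i => by rw [hp₁ i, hpQ₁ i, moduliShear_moduliShear, hγα]) h₁'
  have tB₂ := hB R₂' Q₂ φ₂' x₂' (by rw [hc₂, hcQ₂, himg])
    (fun i => by rw [hp₂ i, hpQ₂ i, moduliShear_moduliShear, hγα]) h₂'
  have e₁ := tendsto_nhds_unique tA₁ tB₁
  have e₂ := tendsto_nhds_unique tA₂ tB₂
  have e : cardyFunction (crossRatio x₁') = cardyFunction (crossRatio x₂') := by rw [← e₁, ← e₂, hcr]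
  have hx := ConformalRectangle.crossRatio_mem_Ioo_of_isUniformizing h₁'
  have hx' := ConformalRectangle.crossRatio_mem_Ioo_of_isUniformizing h₂'
  exact hcr' (strictMonoOn_cardyFunction_holds.injOn ⟨hx.1.le, hx.2.le⟩ ⟨hx'.1.le, hx'.2.le⟩ e)

/-- **`‖α‖ = 1` for every good modulus of a `τ`-invariant family**: `ᾱ⁻¹ = α / ‖α‖²` is again a
good modulus of the upper half-plane (§1, §2), so it equals `α` (§4). [folklore] -/
theorem norm_eq_one_of_cardyMod_of_transpose {P : ConformalRectangle → ℝ → ℝ}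
    (hP : ∀ (R' : ConformalRectangle) (δ : ℝ), P (R'.map transposeHomeomorph) δ = P R' δ)
    {α : ℂ} (hα : 0 < α.im) (h : CardyMod' P α) : ‖α‖ = 1 := by
  have hα0 : α ≠ 0 := fun h0 => by rw [h0] at hα; simp at hα
  have h2 : CardyMod' P (conj α⁻¹) := cardyModOf_conj (cardyModOf_inv_of_transpose hP hα0 h)
  have hns : Complex.normSq α ≠ 0 := (map_ne_zero Complex.normSq).2 hα0
  have hnpos : 0 < Complex.normSq α := lt_of_le_of_ne (Complex.normSq_nonneg α) (Ne.symm hns)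
  have him : (conj α⁻¹).im = α.im / Complex.normSq α := by
    rw [Complex.conj_im, Complex.inv_im, neg_div, neg_neg]
  have hpos : 0 < (conj α⁻¹).im := by rw [him]; exact div_pos hα hnpos
  have heq : α = conj α⁻¹ := modulus_unique' hα hpos h h2
  -- `conj α⁻¹ = α / normSq α`, so `normSq α = 1`
  have key : conj α⁻¹ * (Complex.normSq α : ℂ) = α := by
    rw [Complex.inv_def, map_mul, Complex.conj_conj, Complex.conj_ofReal, mul_assoc, ← Complex.ofReal_mul,
      inv_mul_cancel₀ hns, Complex.ofReal_one, mul_one]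
  rw [← heq] at key
  have hone : (Complex.normSq α : ℂ) = 1 := mul_left_cancel₀ hα0 (key.trans (mul_one α).symm)
  have hone' : Complex.normSq α = 1 := by exact_mod_cast hone
  rw [Complex.normSq_eq_norm_sq] at hone'
  have h3 : (‖α‖ - 1) * (‖α‖ + 1) = 0 := by nlinarith [hone']
  rcases mul_eq_zero.1 h3 with h4 | h4
  · linarith
  · linarith [norm_nonneg α]

/-- **The modulus of every good point of the crux lies on the unit circle**: if the crude corner-model
crossing probabilities at parameter `t` have Cardy limits after `φ_α` with `0 < im α` (i.e. `α`
witnesses `t ∈ G`), then `‖α‖ = 1` — equivalently `α = e^{iθ}`, `θ ∈ (0, π)`. [folklore] -/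
theorem norm_eq_one_of_cardyMod (t : unitInterval) {α : ℂ} (hα : 0 < α.im)
    (h : CardyMod' (cornerCrossingProb t) α) : ‖α‖ = 1 :=
  norm_eq_one_of_cardyMod_of_transpose (cornerCrossingProb_map_transpose t) hα h

/-- Bridge to the route decl: membership in the crux's good set is `∃ α, 0 < im α ∧ CardyMod' …`
(definitional), so every witness has `‖α‖ = 1`. [folklore] -/
theorem goodSet_moduli_norm_one (t : unitInterval)
    (ht : ∃ α : ℂ, 0 < α.im ∧ CardyMod' (cornerCrossingProb t) α) :
    ∃ α : ℂ, 0 < α.im ∧ ‖α‖ = 1 ∧ CardyMod' (cornerCrossingProb t) α := by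
  obtain ⟨α, hα, h⟩ := ht
  exact ⟨α, hα, norm_eq_one_of_cardyMod t hα h, h⟩

end Summit.CriticalPhenomena.CardyFormulaZ2.Theorems.SegmentOpen.Negative

end
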